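import Mathlib
import HarnessLib
import Summits.Ventures.LatticeQCDFlow.Scaling.TorusPlaquetteCoverParity
import Summits.Ventures.LatticeQCDFlow.Scaling.TorusPlaquetteCoverObstruction

/-!
# LatticeQCDFlow / Scaling — hitting sets of plaquettes: the bound `#T ≥ d·#sites/4` is STRICT in
# dimension `d ≥ 5` and for odd `L`; exact plaquette covers of `(ℤ/L)^d` exist iff `d ≤ 4` and `L` is even

HONEST FRAMING: exact (Metropolis-corrected) sampling algorithms for lattice gauge theory;
figures of merit are autocorrelation/cost numbers at stated couplings and volumes; no
continuum-physics claim.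

Venture `LatticeQCDFlow` (cell pub-lqcd), topic `Scaling`, FANOUT row 30 (lean-1, GEN-23) — OUR WORK on
THEORY-2.md §4 row C5 (autoregressive context), the COUNTING step of the volume law; closes the circle
of `Scaling/TorusPlaquetteCoverOrder` (cover ⇒ sharp order), `…CoverParity` (covers in `d = 2, 3, 4`,
`L` even) and `…CoverObstruction` (no cover for `d ≥ 5` or odd `L`).  A set `T` of links HITS the
plaquettes if every plaquette has at least one link in `T` — the set of last links of ANY generation
order of all links is such a set (`Scaling/TorusPlaquetteLastLinks.exists_lastLinks_all`), whence the
per-link count `#T ≥ #plaquettes/(2(d−1)) = d·#sites/4` of the volume laws.  Double counting shows that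
a hitting set achieving `2(d−1)·#T ≤ #plaquettes` is an EXACT COVER; so where no exact cover exists the
count is STRICT for every hitting set, in particular for the last links of every generation order.

## What is proved (all [ours])

* §1 **`plaquetteCover_of_hitting_of_card_le`** — a hitting set `T` with `#T·2(d−1) ≤ #plaquettes` is an
  exact plaquette cover (`d ≥ 2`, `L ≥ 2`).
* §2 **`card_plaquette_lt_of_hitting_of_five_le`** (`d ≥ 5`), **`card_plaquette_lt_of_hitting_of_odd`**
  (`L` odd, `d ≥ 2`): `#plaquettes < #T·2(d−1)` and `d·#sites < 4·#T` for EVERY hitting set `T` — the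
  volume-law count is never attained there.
* §3 **`exists_plaquetteCover_iff`** — for `2 ≤ d`, `2 ≤ L`: an exact plaquette cover of `(ℤ/L)^d`
  exists iff `d ≤ 4 ∧ Even L`.  THE COUNTING CONSTANT `d/4` IS ATTAINED EXACTLY IN THE LATTICE
  DIMENSIONS `d ≤ 4`.

Pure lattice combinatorics.  No `def`, no `sorry`, nothing cited as a fact.
-/

namespace Summit.Ventures.LatticeQCDFlow.Theory2.Autoregressive

open Literature.MathematicalPhysics.QuantumFieldTheory

/-! ## §1 A hitting set at the counting bound is an exact cover -/

/-- **Hitting set at the bound ⇒ exact cover** (`d ≥ 2`, `L ≥ 2`): if every plaquette has a link in `T`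
and `#T·2(d−1) ≤ #plaquettes`, then every plaquette has EXACTLY one link in `T` (double counting: each
link lies on exactly `2(d−1)` plaquettes, so `Σ_p #(T ∩ links p) = #T·2(d−1) ≤ #plaquettes` with every
term `≥ 1`). [ours] -/
theorem plaquetteCover_of_hitting_of_card_le {d L : ℕ} [NeZero L] (hd : 2 ≤ d) (hL : 2 ≤ L)
    (T : Finset (Edge d L))
    (hT : ∀ p : Plaquette d L, ∃ e ∈ ({(p.1, p.2.1.1), (p.1.shift p.2.1.1, p.2.1.2),
        (p.1.shift p.2.1.2, p.2.1.1), (p.1, p.2.1.2)} : Finset (Edge d L)), e ∈ T)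
    (hcard : T.card * (2 * (d - 1)) ≤ Fintype.card (Plaquette d L)) :
    ∀ p : Plaquette d L, ∃ e ∈ ({(p.1, p.2.1.1), (p.1.shift p.2.1.1, p.2.1.2),
        (p.1.shift p.2.1.2, p.2.1.1), (p.1, p.2.1.2)} : Finset (Edge d L)),
      e ∈ T ∧ ∀ e' ∈ ({(p.1, p.2.1.1), (p.1.shift p.2.1.1, p.2.1.2),
        (p.1.shift p.2.1.2, p.2.1.1), (p.1, p.2.1.2)} : Finset (Edge d L)), e' ≠ e → e' ∉ T := by
  classical
  set lk : Plaquette d L → Finset (Edge d L) := fun p =>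
    {(p.1, p.2.1.1), (p.1.shift p.2.1.1, p.2.1.2), (p.1.shift p.2.1.2, p.2.1.1), (p.1, p.2.1.2)} with hlk
  set r : Edge d L → Plaquette d L → Prop := fun e p => e ∈ lk p with hr
  -- double counting
  have habove : ∀ e ∈ T, ((Finset.univ : Finset (Plaquette d L)).bipartiteAbove r e).card = 2 * (d - 1) := by
    intro e _
    have h1 : (Finset.univ : Finset (Plaquette d L)).bipartiteAbove r e =
        Finset.univ.filter (fun p => e ∈ lk p) := by
      ext p; simp [Finset.mem_bipartiteAbove, hr]
    rw [h1]
    exact card_filter_mem_plaquetteLinks_eq hd hL e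
  have hsum := Finset.sum_card_bipartiteAbove_eq_sum_card_bipartiteBelow
    (s := T) (t := (Finset.univ : Finset (Plaquette d L))) r
  rw [Finset.sum_congr rfl habove, Finset.sum_const, smul_eq_mul] at hsum
  -- every term `#(T ∩ links p)` is `≥ 1`, and their sum is `≤ #plaquettes`
  have hge : ∀ p ∈ (Finset.univ : Finset (Plaquette d L)), 1 ≤ (T.bipartiteBelow r p).card := by
    intro p _
    obtain ⟨e, hel, heT⟩ := hT p
    exact Finset.card_pos.2 ⟨e, by rw [Finset.mem_bipartiteBelow]; exact ⟨heT, hel⟩⟩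
  have hle : ∑ p : Plaquette d L, (T.bipartiteBelow r p).card ≤ ∑ _p : Plaquette d L, 1 := by
    rw [← hsum, Finset.sum_const, smul_eq_mul, mul_one, Finset.card_univ]; exact hcard
  have heq : ∀ p ∈ (Finset.univ : Finset (Plaquette d L)), (T.bipartiteBelow r p).card = 1 := by
    have := (Finset.sum_eq_sum_iff_of_le hge).1 (le_antisymm (Finset.sum_le_sum hge) hle)
    exact fun p hp => (this p hp).symm
  intro p
  obtain ⟨e, he⟩ := Finset.card_eq_one.1 (heq p (Finset.mem_univ _))
  have heme : e ∈ T.bipartiteBelow r p := by rw [he]; exact Finset.mem_singleton_self _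
  rw [Finset.mem_bipartiteBelow] at heme
  refine ⟨e, heme.2, heme.1, fun e' he' hne he'T => hne ?_⟩
  have : e' ∈ T.bipartiteBelow r p := by rw [Finset.mem_bipartiteBelow]; exact ⟨he'T, he'⟩
  rw [he] at this
  exact Finset.mem_singleton.1 this

/-! ## §2 The count is strict in dimension `≥ 5` and for odd `L` -/

/-- **Strict count, `d ≥ 5`**: every set of links hitting all plaquettes of `(ℤ/L)^d` (`L ≥ 2`) — e.g.
the last links of any generation order — has `#plaquettes < #T·2(d−1)`. [ours] -/
theorem card_plaquette_lt_of_hitting_of_five_le {d L : ℕ} [NeZero L] (hd : 5 ≤ d) (hL : 2 ≤ L)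
    (T : Finset (Edge d L))
    (hT : ∀ p : Plaquette d L, ∃ e ∈ ({(p.1, p.2.1.1), (p.1.shift p.2.1.1, p.2.1.2),
        (p.1.shift p.2.1.2, p.2.1.1), (p.1, p.2.1.2)} : Finset (Edge d L)), e ∈ T) :
    Fintype.card (Plaquette d L) < T.card * (2 * (d - 1)) := by
  by_contra h
  exact not_plaquetteCover_of_five_le hd hL T
    (plaquetteCover_of_hitting_of_card_le (by omega) hL T hT (not_lt.1 h))

/-- **Strict count, odd `L`** (`d ≥ 2`, `L ≥ 2`): every set of links hitting all plaquettes has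
`#plaquettes < #T·2(d−1)`. [ours] -/
theorem card_plaquette_lt_of_hitting_of_odd {d L : ℕ} [NeZero L] (hd : 2 ≤ d) (hL : 2 ≤ L)
    (hodd : Odd L) (T : Finset (Edge d L))
    (hT : ∀ p : Plaquette d L, ∃ e ∈ ({(p.1, p.2.1.1), (p.1.shift p.2.1.1, p.2.1.2),
        (p.1.shift p.2.1.2, p.2.1.1), (p.1, p.2.1.2)} : Finset (Edge d L)), e ∈ T) :
    Fintype.card (Plaquette d L) < T.card * (2 * (d - 1)) := by
  by_contra h
  have heven := even_of_plaquetteCover hd hL T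
    (plaquetteCover_of_hitting_of_card_le hd hL T hT (not_lt.1 h))
  exact (Nat.not_even_iff_odd.2 hodd) heven

/-- **Strict count in site form**: `d·#sites < 4·#T` for every hitting set, when `d ≥ 5` (`L ≥ 2`). [ours] -/
theorem mul_card_site_lt_of_hitting_of_five_le {d L : ℕ} [NeZero L] (hd : 5 ≤ d) (hL : 2 ≤ L)
    (T : Finset (Edge d L))
    (hT : ∀ p : Plaquette d L, ∃ e ∈ ({(p.1, p.2.1.1), (p.1.shift p.2.1.1, p.2.1.2),
        (p.1.shift p.2.1.2, p.2.1.1), (p.1, p.2.1.2)} : Finset (Edge d L)), e ∈ T) :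
    d * Fintype.card (Site d L) < 4 * T.card := by
  have h1 := card_plaquette_lt_of_hitting_of_five_le hd hL T hT
  have h2 := two_mul_card_plaquette d L
  -- `(d-1)·(d·#sites) = 2·#plaquettes·… < (d-1)·(4·#T)`
  have h3 : (d - 1) * (d * Fintype.card (Site d L)) < (d - 1) * (4 * T.card) := by
    calc (d - 1) * (d * Fintype.card (Site d L)) = 2 * Fintype.card (Plaquette d L) := by rw [h2]; ring
      _ < 2 * (T.card * (2 * (d - 1))) := by omega
      _ = (d - 1) * (4 * T.card) := by ring
  exact Nat.lt_of_mul_lt_mul_left h3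

/-! ## §3 Exact covers exist iff `d ≤ 4` and `L` is even -/

/-- **Characterisation.**  For `2 ≤ d` and `2 ≤ L`, an exact plaquette cover of `(ℤ/L)^d` exists if and
only if `d ≤ 4` and `L` is even: the counting constant `d/4` of the volume law
(`Scaling/TorusPlaquetteLastLinks`, `Scaling/AutoregressiveGaugeKLExtensiveAllPlanes…`) is attained by
a generation order (`Scaling/TorusPlaquetteCoverOrder.exists_sharp_order_of_cover`) exactly in the
lattice dimensions `2, 3, 4` with even side. [ours] -/
theorem exists_plaquetteCover_iff {d L : ℕ} [NeZero L] (hd : 2 ≤ d) (hL : 2 ≤ L) :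
    (∃ C : Finset (Edge d L), ∀ p : Plaquette d L, ∃ e ∈ ({(p.1, p.2.1.1), (p.1.shift p.2.1.1, p.2.1.2),
        (p.1.shift p.2.1.2, p.2.1.1), (p.1, p.2.1.2)} : Finset (Edge d L)),
      e ∈ C ∧ ∀ e' ∈ ({(p.1, p.2.1.1), (p.1.shift p.2.1.1, p.2.1.2),
        (p.1.shift p.2.1.2, p.2.1.1), (p.1, p.2.1.2)} : Finset (Edge d L)), e' ≠ e → e' ∉ C) ↔
    d ≤ 4 ∧ Even L := by
  constructor
  · rintro ⟨C, hC⟩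
    refine ⟨?_, even_of_plaquetteCover hd hL C hC⟩
    by_contra h5
    exact not_plaquetteCover_of_five_le (by omega) hL C hC
  · rintro ⟨hd4, hev⟩
    have h2 : 2 ∣ L := even_iff_two_dvd.1 hev
    interval_cases d
    · exact exists_plaquetteCover_two h2
    · exact exists_plaquetteCover_three h2
    · exact exists_plaquetteCover_four h2

end Summit.Ventures.LatticeQCDFlow.Theory2.Autoregressive
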